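/-
COR-CM (cell pub-hodgecm2) — TEAM hComp (coordinator ruling 2026-08-21T18:44:30Z), seat hcomp-compare-1, table row C1: COMPARISON
MAPS 1.  Count-neutral (no BINDER-OWNERS row, no hypothesis binder); HC_CM is NOT proved and nothing here bears on it.
-/
import Summits.HodgeConjecture.CorCM.HermSpaceTransport
import Literature.NumberTheory.Automorphic.Liu2021.AppendixC.DefC1toC3
import Literature.NumberTheory.Automorphic.Liu2021.AppendixC.DefC4Aux
import Literature.NumberTheory.Automorphic.Liu2021.AppendixC.PropC5
import HarnessLib

/-!
# COR-CM / hComp — comparison record: Liu's hermitian space and unitary group ↔ the tree's `HermSpace3` and `adelicFin`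

The pinning record for S2 (`Transposition/Item6PinReach*.lean`) instantiates Liu's Appendix-C datum
`PropC5Data (maximalRealSubfield F) F` ([Liu2021] App. C as printed, `Liu2021/AppendixC/PropC5.lean`) on the TREE's
hermitian 3-space `V : HermSpace3 F ι₁` of a CM field `F : CMField` (`CorCM/CM/Basic.lean`): Liu's totally real field is
`F⁺ = maximalRealSubfield F`, Liu's CM extension `E` is `F`, Liu's involution `c` is complex conjugation, Liu's `V(τ)` at the
real place `τ` under `ι₁` is `V`, and Liu's `G(τ)(𝔸^∞) = U(V(τ))(𝔸_{F⁺}^∞)` is the tree's `V.adelicFin`.  This file is the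
EXPLICIT COMPARISON RECORD between the two vocabularies — Liu's, as typed statement-exactly by the Appendix-C typers
(`AppendixC/DefC1toC3.lean`: `HermSpace`, `HermSpace.gram`, `.rationalPoints`, `.Gfin`, `.sig`, `.IsSignatureN1At`;
`AppendixC/DefC4.lean`: `HasSignatureAt`, `LiesAbove`, `matrixOfForm`; `AppendixC/PropC5.lean`: `C5.IsAbove`), and the tree's
(`HermSpace3`, `HermSpace3.adelicFin`, `UnitaryGroup.rational`) — with every identification a named lemma (here `L` is the
CM field, `L⁺ = maximalRealSubfield L`):

* §0 field dictionary: Liu's standing hypotheses of l. 4550 hold for `(L⁺, L)` (instances, `CMField.liuStanding`); Liu's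
  `c = AppendixC.conj L⁺ L` IS Mathlib's `IsCMField.complexConj L` (`CMField.liuConj_eq_complexConj`; as ring maps
  `= cmConjRingHom L`); the real embedding `τ₁ := restr L⁺ L ι₁` of `L⁺` under `ι₁` satisfies `C5.IsAbove τ₁ ι₁` /
  `LiesAbove ι₁ τ₁` and is the pin's own `hreal.embedding`; a complex embedding `τ'` lies above `τ₁` iff it defines the
  PLACE of `ι₁` (`CMField.liesAbove_restr_iff_mk_eq`) — Liu's «other places `τ₀ ≠ τ`» are the tree's
  `InfinitePlace.mk τ ≠ InfinitePlace.mk ι₁`.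
* §1 (Def. C.4's matrix reading, typer 2) `HasSignatureAt τ₁ V.Hm 2 1` and `HasSignatureAt τ V.Hm 3 0` for `τ ≠ τ₁`.
* §2 (l. 4558's space reading, typer 1) the REAL hermitian space `V.toLiu : AppendixC.HermSpace L⁺ L` (`L³` with the form
  `(x, y) = Σ c(yᵢ) Hᵢⱼ xⱼ`, of Gram matrix `V.Hm` in the standard basis: `matrixOfForm_toLiu_basisFun`), its Gram matrix in
  typer 1's chosen basis `= ᵗ(cP) · Hm · P` for the explicit change-of-basis matrix `P = V.toLiuBasisMatrix ∈ GL₃(L)`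
  (`toLiu_gram`), whence the unitary groups: **`V.gfinEquiv : V.toLiu.Gfin ≃ₜ* V.adelicFin`**, `g ↦ P_f g P_f⁻¹`
  (topological groups; tree `UnitaryGroup.finAdelicCongr`), and `γ ∈ V.toLiu.rationalPoints ↔ P γ P⁻¹ ∈ U(V)(L⁺)`
  (`mem_toLiu_rationalPoints_iff`).

Nothing is cited as a record; every statement is proved.  T5: n/a (no hypothesis binder).  References: [Liu2021] App. C
l. 4550, 4558, 4569–4573, 4599, Rem. C.2, Def. C.4, l. 4624 (FJcycle.tex lines, as in the typers' files); Platonov–Rapinchuk 1994 §2.3.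
-/

noncomputable section

open scoped Matrix ComplexOrder
open NumberField
open Literature.NumberTheory.Automorphic
open Literature.NumberTheory.Automorphic.Liu2021.AppendixC
open Literature.AlgebraicGeometry.ShimuraVarieties

namespace Summit.HodgeConjecture.CorCM

/-! ## §0  The field dictionary `(F, E, c, τ) := (L⁺, L, complex conjugation, ι₁|L⁺)` -/

namespace CMField

variable (L : CMField)

/-- Liu's standing hypotheses (App. C l. 4550: `F` totally real number field, `E/F` totally imaginary quadratic) hold for
`(F, E) := (L⁺, L)`, `L` a CM field — all are Mathlib instances; recorded so that an auditor sees the instance path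
(`isTotallyReal_maximalRealSubfield`, `IsCMField.isTotallyComplex`, `IsCMField.isQuadraticExtension`). [cite: Liu2021, App. C l. 4550] -/
theorem liuStanding :
    IsTotallyReal (maximalRealSubfield L) ∧ IsTotallyComplex L ∧
      Algebra.IsQuadraticExtension (maximalRealSubfield L) L :=
  ⟨inferInstance, inferInstance, inferInstance⟩

/-- **Liu's involution `c` IS complex conjugation**: typer 1's `AppendixC.conj L⁺ L` («the nontrivial involution of `E` over
`F`», l. 4550, typed as `IsCMField.complexConj` for the CM structure `IsCMField.ofCMExtension L⁺ L`) equals Mathlib's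
`IsCMField.complexConj L` for the CM field's own structure (the two `IsCMField L` instances prove one `Prop`).
[cite: Liu2021, App. C l. 4550] -/
theorem liuConj_eq_complexConj :
    Liu2021.AppendixC.conj (maximalRealSubfield L) L = IsCMField.complexConj L := by
  ext x
  rfl

/-- Pointwise: Liu's `c` is the tree's `cmConjRingHom L` (the currency of `HermSpace3.isHermitian`). [cite: Liu2021, App. C l. 4550] -/
theorem liuConj_apply (x : L) : Liu2021.AppendixC.conj (maximalRealSubfield L) L x = cmConjRingHom L x := rfl

/-- As ring maps: Liu's `c` is the tree's `cmConjRingHom L` (the currency of `Level.isCongruence`, `unitaryGroupOfForm`).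
[cite: Liu2021, App. C l. 4550] -/
theorem coe_liuConj_eq_cmConjRingHom :
    ((Liu2021.AppendixC.conj (maximalRealSubfield L) L : L ≃ₐ[maximalRealSubfield L] L) : L →+* L) = cmConjRingHom L :=
  RingHom.ext fun _ => rfl

variable {L}

/-- `τ₁ := π(ι₁) = restr L⁺ L ι₁`, the real embedding of `L⁺` under `ι₁` (typer 1's `restr`, l. 4550 «`π` given by
restriction»), is BELOW `ι₁` in Prop. C.5's sense `C5.IsAbove τ₁ ι₁` (typer 3) — the `hτ` fed to `PropC5AsPrinted` /
`IncoherentShimuraSystem.iso` by the pin (`Item6PinReachGlue.lean`, `hComp_of_unif_of_alb`). [cite: Liu2021, App. C l. 4550] -/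
theorem isAbove_restr (ι₁ : L →+* ℂ) : C5.IsAbove (restr (maximalRealSubfield L) L ι₁) ι₁ :=
  comp_algebraMap_eq_restr (maximalRealSubfield L) L ι₁

/-- The same in Def. C.4's spelling `LiesAbove ι₁ τ₁` (typer 2). [cite: Liu2021, App. C l. 4550] -/
theorem liesAbove_restr (ι₁ : L →+* ℂ) : LiesAbove ι₁ (restr (maximalRealSubfield L) L ι₁) :=
  fun x => (restr_apply_coe (maximalRealSubfield L) L ι₁ x).symm

/-- The pin's own construction of `τ` (`Item6PinReachGlue.lean`: `hreal.embedding` for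
`hreal : IsReal (ι₁.comp (algebraMap L⁺ L))`) IS `restr L⁺ L ι₁` — one real embedding, two spellings.
[cite: Liu2021, App. C l. 4550] -/
theorem restr_eq_embedding (ι₁ : L →+* ℂ)
    (hreal : ComplexEmbedding.IsReal (ι₁.comp (algebraMap (maximalRealSubfield L) L))) :
    restr (maximalRealSubfield L) L ι₁ = hreal.embedding := rfl

/-- **Liu's «`τ'` above `τ₁`» ↔ the tree's «`τ'` defines the place of `ι₁`»**: a complex embedding of the CM field `L` lies
above the real embedding `τ₁ = ι₁|L⁺` iff `InfinitePlace.mk τ' = InfinitePlace.mk ι₁` (iff it is `ι₁` or its conjugate).  Hence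
Liu's «signature `(n, 0)` at other places `τ₀ ≠ τ`» (Rem. C.2) ranges over exactly the tree's `InfinitePlace.mk τ ≠ mk ι₁`
(`HermSpace3.posDef_of_ne`). [cite: Liu2021, App. C l. 4550] -/
theorem liesAbove_restr_iff_mk_eq (ι₁ τ' : L →+* ℂ) :
    LiesAbove τ' (restr (maximalRealSubfield L) L ι₁) ↔ InfinitePlace.mk τ' = InfinitePlace.mk ι₁ := by
  constructor
  · intro h
    apply (IsCMField.equivInfinitePlace (K := L)).injective
    rw [IsCMField.equivInfinitePlace_apply, IsCMField.equivInfinitePlace_apply, InfinitePlace.comap_mk,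
      InfinitePlace.comap_mk]
    congr 1
    ext x
    change τ' (algebraMap _ L x) = ι₁ (algebraMap _ L x)
    rw [h x]
    exact restr_apply_coe (maximalRealSubfield L) L ι₁ x
  · intro h
    rcases InfinitePlace.mk_eq_iff.mp h with h₁ | h₁
    · rw [h₁]; exact liesAbove_restr ι₁
    · intro x
      have h2 := liesAbove_restr (ComplexEmbedding.conjugate τ') x
      rw [ComplexEmbedding.conjugate_coe_eq] at h2
      rw [← h₁, ← Complex.conj_conj (τ' _), h2, Complex.conj_ofReal]

/-- Every real embedding `τ ∈ Φ_{L⁺}` is `π(τ')` for some complex embedding `τ'` of `L` (`π` is onto; `IsAlgClosed.lift`).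
(Also in typer 1's companion `DefC1toC3Aux.exists_restr_eq`; reproved here to keep this file's imports built.)
[cite: Liu2021, App. C l. 4550] -/
theorem exists_liuRestr_eq (τ : maximalRealSubfield L →+* ℝ) : ∃ τ' : L →+* ℂ, restr (maximalRealSubfield L) L τ' = τ := by
  obtain ⟨w, hw⟩ := InfinitePlace.comap_surjective (k := maximalRealSubfield L) (K := L)
    (InfinitePlace.mk (Complex.ofRealHom.comp τ))
  have h1 : InfinitePlace.mk (w.embedding.comp (algebraMap (maximalRealSubfield L) L)) =
      InfinitePlace.mk (Complex.ofRealHom.comp τ) := by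
    rw [← InfinitePlace.comap_mk, InfinitePlace.mk_embedding]; exact hw
  have hreal : ComplexEmbedding.conjugate (Complex.ofRealHom.comp τ) = Complex.ofRealHom.comp τ := by
    ext x
    rw [ComplexEmbedding.conjugate_coe_eq, RingHom.comp_apply, Complex.ofRealHom_eq_coe, Complex.conj_ofReal]
  have h2 : w.embedding.comp (algebraMap (maximalRealSubfield L) L) = Complex.ofRealHom.comp τ := by
    rcases InfinitePlace.mk_eq_iff.mp h1 with h | h
    · exact h
    · have h' := congrArg ComplexEmbedding.conjugate h
      rw [NumberField.ComplexEmbedding.involutive_conjugate, hreal] at h'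
      exact h'
  refine ⟨w.embedding, ?_⟩
  ext x
  apply Complex.ofReal_injective
  rw [restr_apply_coe, ← RingHom.comp_apply, h2, RingHom.comp_apply, Complex.ofRealHom_eq_coe]

/-- Restriction version: `π(τ') = π(ι₁) ↔ mk τ' = mk ι₁`. [cite: Liu2021, App. C l. 4550] -/
theorem restr_eq_restr_iff_mk_eq (ι₁ τ' : L →+* ℂ) :
    restr (maximalRealSubfield L) L τ' = restr (maximalRealSubfield L) L ι₁ ↔
      InfinitePlace.mk τ' = InfinitePlace.mk ι₁ := by
  rw [← liesAbove_restr_iff_mk_eq]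
  constructor
  · intro h x
    rw [← h]
    exact (restr_apply_coe (maximalRealSubfield L) L τ' x).symm
  · intro h
    ext x
    exact Complex.ofReal_injective ((restr_apply_coe (maximalRealSubfield L) L τ' x).trans (h x))

end CMField

/-! ## §1  Def. C.4's matrix signature (typer 2's `HasSignatureAt`) for the tree's Gram matrix `V.Hm` -/

/-- A positive definite complex hermitian matrix is congruent to the identity by an invertible matrix
(`T = U · diag(λ^{-1/2})` for a unitary diagonalisation `Uᴴ A U = diag(λ)`, `λ > 0`). [folklore] -/
theorem exists_congr_one_of_posDef {n : Type} [Fintype n] [DecidableEq n] {A : Matrix n n ℂ} (hA : A.PosDef) :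
    ∃ T : GL n ℂ, (T : Matrix n n ℂ)ᴴ * A * (T : Matrix n n ℂ) = 1 := by
  have hH : A.IsHermitian := hA.isHermitian
  set U : Matrix n n ℂ := (hH.eigenvectorUnitary : Matrix n n ℂ) with hUdef
  set D : Matrix n n ℂ := Matrix.diagonal (RCLike.ofReal ∘ hH.eigenvalues) with hDdef
  have hU : Uᴴ * A * U = D := by
    have h := hH.conjStarAlgAut_star_eigenvectorUnitary
    rw [Unitary.conjStarAlgAut_star_apply, Matrix.star_eq_conjTranspose] at h
    exact h
  have hUU : Uᴴ * U = 1 := by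
    have h := Unitary.coe_star_mul_self hH.eigenvectorUnitary
    rwa [Matrix.star_eq_conjTranspose] at h
  set s : n → ℂ := fun i => ((Real.sqrt (hH.eigenvalues i) : ℝ) : ℂ)⁻¹ with hsdef
  set S : Matrix n n ℂ := Matrix.diagonal s with hSdef
  have hpos : ∀ i, 0 < hH.eigenvalues i := hA.eigenvalues_pos
  have hs : ∀ i, s i * (hH.eigenvalues i : ℂ) * s i = 1 := fun i => by
    have hq : ((Real.sqrt (hH.eigenvalues i) : ℝ) : ℂ) * ((Real.sqrt (hH.eigenvalues i) : ℝ) : ℂ) =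
        (hH.eigenvalues i : ℂ) := by
      rw [← Complex.ofReal_mul, Real.mul_self_sqrt (hpos i).le]
    have hne : ((Real.sqrt (hH.eigenvalues i) : ℝ) : ℂ) ≠ 0 := by
      exact_mod_cast (Real.sqrt_pos.mpr (hpos i)).ne'
    rw [hsdef]
    field_simp
    rw [sq, hq]
  have hSstar : Sᴴ = S := by
    rw [hSdef, Matrix.diagonal_conjTranspose]
    congr 1
    funext i
    simp [hsdef]
  have hSDS : Sᴴ * D * S = 1 := by
    rw [hSstar, hSdef, hDdef, Matrix.diagonal_mul_diagonal, Matrix.diagonal_mul_diagonal, ← Matrix.diagonal_one]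
    congr 1
    funext i
    simpa [Function.comp] using hs i
  have hdetU : IsUnit U.det := Matrix.isUnit_det_of_left_inverse hUU
  have hdetS : IsUnit S.det := by
    have hSS : Sᴴ * (D * S) = 1 := by rw [← Matrix.mul_assoc]; exact hSDS
    rw [hSstar] at hSS
    exact Matrix.isUnit_det_of_right_inverse hSS
  have hdet : IsUnit (U * S).det := by rw [Matrix.det_mul]; exact hdetU.mul hdetS
  refine ⟨Matrix.nonsingInvUnit (U * S) hdet, ?_⟩
  change (U * S)ᴴ * A * (U * S) = 1
  rw [Matrix.conjTranspose_mul]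
  calc Sᴴ * Uᴴ * A * (U * S) = Sᴴ * (Uᴴ * A * U) * S := by simp only [Matrix.mul_assoc]
    _ = 1 := by rw [hU, hSDS]

namespace HermSpace3

variable {L : CMField} {ι₁ : L →+* ℂ} (V : HermSpace3 L ι₁)

/-- **«`V ⊗_{F,τ₁} ℝ` has signature `(2, 1)`»** in Def. C.4's matrix reading (`HasSignatureAt τ₁ V.Hm 2 1`, typer 2), from
the tree's Sylvester datum `signature_ι₁ : ∃ T, Tᴴ · Hm^{ι₁} · T = diag(1,1,−1)` through typer 2's bridge
`hasSignatureAt_of_signatureMatrix`. [cite: Liu2021, App. C l. 4573] -/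
theorem hasSignatureAt_restr : HasSignatureAt (restr (maximalRealSubfield L) L ι₁) V.Hm 2 1 :=
  hasSignatureAt_of_signatureMatrix _ V.Hm ι₁ (CMField.liesAbove_restr ι₁) V.signature_ι₁

/-- **«`V ⊗_{F,τ} ℝ` has signature `(3, 0)` at the other real places»** (`HasSignatureAt τ V.Hm 3 0` for `τ ≠ τ₁`, typer 2's
predicate), from the tree's `posDef_of_ne` at an embedding `τ'` above `τ` (which does not define the place of `ι₁`, §0).
[cite: Liu2021, App. C l. 4573] -/
theorem hasSignatureAt_of_ne {τ : maximalRealSubfield L →+* ℝ} (hτ : τ ≠ restr (maximalRealSubfield L) L ι₁) :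
    HasSignatureAt τ V.Hm 3 0 := by
  obtain ⟨τ', hτ'⟩ := CMField.exists_liuRestr_eq τ
  have hne : InfinitePlace.mk τ' ≠ InfinitePlace.mk ι₁ := fun hmk =>
    hτ (hτ'.symm.trans ((CMField.restr_eq_restr_iff_mk_eq ι₁ τ').mpr hmk))
  obtain ⟨T, hT⟩ := exists_congr_one_of_posDef (V.posDef_of_ne τ' hne)
  refine ⟨rfl, τ', ?_, T, ?_⟩
  · intro x
    rw [← hτ']
    exact (restr_apply_coe (maximalRealSubfield L) L τ' x).symm
  · rw [hT]
    unfold signatureDiag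
    rw [← Matrix.diagonal_one]
    congr 1
    funext i
    simp [i.2]

/-! ## §2  Liu's hermitian space over `E = L` attached to the tree's `V` (typer 1's `HermSpace`), its Gram matrix and groups -/

/-- The sesquilinear form of Gram matrix `Hm` on `L³` in Liu's convention (l. 4558, «`E`-linear in the first variable»;
typer 1's READING R4 `(x, y)_V = Σ_{i,j} c(yᵢ) · Jᵢⱼ · xⱼ`). [cite: Liu2021, App. C l. 4558] -/
def liuForm (x y : Fin 3 → L) : L := ∑ i, ∑ j, cmConjRingHom L (y i) * V.Hm i j * x j

/-- Unfolding of `liuForm`. [cite: Liu2021, App. C l. 4558] -/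
theorem liuForm_apply (x y : Fin 3 → L) : V.liuForm x y = ∑ i, ∑ j, cmConjRingHom L (y i) * V.Hm i j * x j := rfl

/-- `liuForm` against a standard basis vector on the right reads off `Hm · x`. [cite: Liu2021, App. C l. 4558] -/
theorem liuForm_single_right (x : Fin 3 → L) (i : Fin 3) : V.liuForm x (Pi.single i 1) = (V.Hm *ᵥ x) i := by
  rw [liuForm_apply, Matrix.mulVec, dotProduct, Finset.sum_eq_single i]
  · simp
  · intro b _ hb
    simp [Pi.single_eq_of_ne hb]
  · intro h; exact absurd (Finset.mem_univ i) h

/-- `liuForm` on two standard basis vectors reads off the Gram entry: `(e_j, e_i) = Hm i j`. [cite: Liu2021, App. C l. 4558] -/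
theorem liuForm_single_single (i j : Fin 3) : V.liuForm (Pi.single j 1) (Pi.single i 1) = V.Hm i j := by
  rw [liuForm_single_right, Matrix.mulVec_single_one]
  rfl

/-- **Liu's hermitian space `V(τ₁)` attached to the tree's `V`** — typer 1's REAL structure `AppendixC.HermSpace L⁺ L`
(«a (non-degenerate) hermitian space over `E` (with respect to `c`) of rank `n ≥ 1`, with the hermitian form
`( , )_V : V × V → E` that is `E`-linear in the first variable», l. 4558): underlying space `L³`, rank `n := 3`, form `liuForm`
(hermitian by `HermSpace3.isHermitian`, non-degenerate by `HermSpace3.det_ne_zero`). [cite: Liu2021, App. C l. 4558] -/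
abbrev toLiu : Liu2021.AppendixC.HermSpace (maximalRealSubfield L) L where
  V := Fin 3 → L
  n := 3
  one_le_n := by norm_num
  finrank_eq := Module.finrank_fin_fun L
  form := V.liuForm
  form_add_left x y z := by
    simp only [liuForm_apply, Pi.add_apply, mul_add, Finset.sum_add_distrib]
  form_smul_left a x y := by
    simp only [liuForm_apply, Pi.smul_apply, smul_eq_mul, Finset.mul_sum]
    refine Finset.sum_congr rfl fun i _ => Finset.sum_congr rfl fun j _ => ?_
    ring
  form_herm x y := by
    rw [CMField.liuConj_apply]
    have hcc : ∀ z : L, cmConjRingHom L (cmConjRingHom L z) = z := fun z => IsCMField.complexConj_apply_apply L z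
    simp only [liuForm_apply, map_sum, map_mul, hcc, V.isHermitian]
    rw [Finset.sum_comm]
    refine Finset.sum_congr rfl fun i _ => Finset.sum_congr rfl fun j _ => ?_
    ring
  form_nondeg x hx := by
    have hmul : V.Hm *ᵥ x = 0 := by
      funext i
      rw [← liuForm_single_right]
      exact hx _
    exact Matrix.eq_zero_of_mulVec_eq_zero V.det_ne_zero hmul

/-- Liu's rank `n` is `3`. [cite: Liu2021, App. C l. 4558] -/
@[simp] theorem toLiu_n : V.toLiu.n = 3 := rfl

/-- Liu's form is `liuForm`. [cite: Liu2021, App. C l. 4558] -/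
theorem toLiu_form (x y : Fin 3 → L) : V.toLiu.form x y = V.liuForm x y := rfl

/-- **The Gram matrix of Liu's `V(τ₁)` in the STANDARD basis of `L³` is the tree's `Hm`** (typer 2's `matrixOfForm`, the
convention «entry `(i, j)` is `(b_j, b_i)`» of Def. C.4 READING N1). [cite: Liu2021, App. C l. 4558] -/
theorem matrixOfForm_toLiu_basisFun : matrixOfForm (M := Fin 3 → L) V.toLiu.form (Pi.basisFun L (Fin 3)) = V.Hm := by
  ext i j
  rw [matrixOfForm_apply]
  simp only [Pi.basisFun_apply]
  exact V.liuForm_single_single i j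

/-- The change-of-basis matrix from typer 1's chosen basis `HermSpace.basis` of `V(τ₁) = L³` (a `Module.finBasisOfFinrankEq`)
to the standard basis: column `i` = the coordinates of the `i`-th chosen basis vector.  (Liu's objects do not depend on the
basis; typer 1 fixed one to write `gram`, and this matrix makes the dependence explicit.) [cite: Liu2021, App. C l. 4558] -/
def toLiuBasisMat : Matrix (Fin 3) (Fin 3) L := (Pi.basisFun L (Fin 3)).toMatrix V.toLiu.basis

/-- Entries: `P i' i = (b_i)_{i'}`. [cite: Liu2021, App. C l. 4558] -/
theorem toLiuBasisMat_apply (i' i : Fin 3) : V.toLiuBasisMat i' i = (V.toLiu.basis i : Fin 3 → L) i' := by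
  rw [toLiuBasisMat, Module.Basis.toMatrix_apply, Pi.basisFun_repr]

/-- The change-of-basis matrix is invertible (two bases). [cite: Liu2021, App. C l. 4558] -/
instance invertibleToLiuBasisMat : Invertible V.toLiuBasisMat :=
  (Pi.basisFun L (Fin 3)).invertibleToMatrix V.toLiu.basis

/-- **The change-of-basis matrix `P ∈ GL₃(L)`** (typer 1's chosen basis of `V(τ₁)` against the standard basis of `L³`).
[cite: Liu2021, App. C l. 4558] -/
def toLiuBasisMatrix : GL (Fin 3) L := unitOfInvertible V.toLiuBasisMat

/-- Underlying matrix of `toLiuBasisMatrix`. [cite: Liu2021, App. C l. 4558] -/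
@[simp] theorem coe_toLiuBasisMatrix : (V.toLiuBasisMatrix : Matrix (Fin 3) (Fin 3) L) = V.toLiuBasisMat := rfl

/-- **Liu's Gram matrix `J` (typer 1's `HermSpace.gram`, in the chosen basis) is `ᵗ(cP) · Hm · P`** — the tree's `formCongr`
of `Hm` by the change of basis `P` (`J i j = (b_j, b_i) = Σ c(P_{i'i}) Hm_{i'j'} P_{j'j}`). [cite: Liu2021, App. C l. 4558] -/
theorem toLiu_gram : V.toLiu.gram = formCongr (cmConjRingHom L) V.toLiuBasisMatrix V.Hm := by
  ext i j
  change V.liuForm (V.toLiu.basis j) (V.toLiu.basis i) = _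
  rw [liuForm_apply, formCongr, coe_toLiuBasisMatrix, Matrix.mul_apply]
  simp only [Matrix.mul_apply, Matrix.transpose_apply, Matrix.map_apply, toLiuBasisMat_apply, Finset.sum_mul]
  rw [Finset.sum_comm]

/-- The same with the scalar `a = 1` and the conjugation spelled as Mathlib's `IsCMField.complexConj L` — the hypothesis
shape of the tree's `UnitaryGroup.finAdelicCongr` / `conj_mem_rational_iff`. [cite: Liu2021, App. C l. 4558] -/
theorem formCongr_one_smul_eq_toLiu_gram :
    formCongr ((IsCMField.complexConj L : L ≃ₐ[↥(maximalRealSubfield L)] L) : L →+* L) V.toLiuBasisMatrix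
      ((1 : L) • V.Hm) = V.toLiu.gram := by
  rw [one_smul, toLiu_gram]
  rfl

/-- **Liu's `G(τ₁)(𝔸^∞) = U(V(τ₁))(𝔸_{F}^∞)` (typer 1's `HermSpace.Gfin`, l. 4599/4624) is the tree's `V.adelicFin`, up to
the conjugation by the change of basis**: `V.toLiu.Gfin ≃ₜ* V.adelicFin`, `g ↦ P_f g P_f⁻¹`, an isomorphism of topological
groups inside `GL₃(𝔸_L^∞)` (tree `UnitaryGroup.finAdelicCongr`; both sides are `UnitaryGroup.finAdelic L⁺ L c 3 (·)` at
congruent Gram matrices, Liu's `c` being `complexConj`, §0). [cite: Liu2021, App. C l. 4599, 4624] -/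
def gfinEquiv : V.toLiu.Gfin ≃ₜ* V.adelicFin :=
  UnitaryGroup.finAdelicCongr (↥(maximalRealSubfield L)) L (IsCMField.complexConj L) V.toLiuBasisMatrix
    (one_ne_zero (α := L)) V.formCongr_one_smul_eq_toLiu_gram

/-- `gfinEquiv` on underlying matrices: `g ↦ P_f g P_f⁻¹` (`P_f` = the diagonal image of `P` in `GL₃(𝔸_L^∞)`).
[cite: Liu2021, App. C l. 4599, 4624] -/
theorem coe_gfinEquiv_apply (g : V.toLiu.Gfin) :
    ((V.gfinEquiv g : V.adelicFin) : GL (Fin 3) (IsDedekindDomain.FiniteAdeleRing (𝓞 L) L)) =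
      UnitaryGroup.toFinAdeleGL L 3 V.toLiuBasisMatrix * (g : GL (Fin 3) (IsDedekindDomain.FiniteAdeleRing (𝓞 L) L)) *
        (UnitaryGroup.toFinAdeleGL L 3 V.toLiuBasisMatrix)⁻¹ :=
  rfl

/-- `gfinEquiv.symm` on underlying matrices: `g ↦ P_f⁻¹ g P_f`. [cite: Liu2021, App. C l. 4599, 4624] -/
theorem coe_gfinEquiv_symm_apply (g : V.adelicFin) :
    ((V.gfinEquiv.symm g : V.toLiu.Gfin) : GL (Fin 3) (IsDedekindDomain.FiniteAdeleRing (𝓞 L) L)) =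
      (UnitaryGroup.toFinAdeleGL L 3 V.toLiuBasisMatrix)⁻¹ *
        (g : GL (Fin 3) (IsDedekindDomain.FiniteAdeleRing (𝓞 L) L)) * UnitaryGroup.toFinAdeleGL L 3 V.toLiuBasisMatrix :=
  rfl

/-- **Liu's rational points `U(V(τ₁))(F)` (typer 1's `HermSpace.rationalPoints`, l. 4569–4571) are the tree's
`U(V)(L⁺) = UnitaryGroup.rational L⁺ L c 3 Hm` up to conjugation by `P`**: `γ ∈ U(V(τ₁))(F) ↔ P γ P⁻¹ ∈ U(V)(L⁺)`.
[cite: Liu2021, App. C l. 4569–4571] -/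
theorem mem_toLiu_rationalPoints_iff (γ : GL (Fin 3) L) :
    γ ∈ V.toLiu.rationalPoints ↔
      V.toLiuBasisMatrix * γ * V.toLiuBasisMatrix⁻¹ ∈
        UnitaryGroup.rational (↥(maximalRealSubfield L)) L (IsCMField.complexConj L) 3 V.Hm :=
  UnitaryGroup.conj_mem_rational_iff (↥(maximalRealSubfield L)) L (IsCMField.complexConj L) V.toLiuBasisMatrix
    (one_ne_zero (α := L)) V.formCongr_one_smul_eq_toLiu_gram γ

/-- In particular the arithmetic group `Γ ≤ U(V)(L⁺)` of a tree level (`Level.Γ_le_rational`) is carried into Liu's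
`U(V(τ₁))(F)` by `γ ↦ P⁻¹ γ P`. [cite: Liu2021, App. C l. 4569–4571] -/
theorem conj_mem_toLiu_rationalPoints (Γ : Level V) {δ : GL (Fin 3) L} (hδ : δ ∈ Γ.Γ) :
    V.toLiuBasisMatrix⁻¹ * δ * V.toLiuBasisMatrix ∈ V.toLiu.rationalPoints := by
  rw [mem_toLiu_rationalPoints_iff]
  have h : V.toLiuBasisMatrix * (V.toLiuBasisMatrix⁻¹ * δ * V.toLiuBasisMatrix) * V.toLiuBasisMatrix⁻¹ = δ := by group
  rw [h]
  exact Γ.Γ_le_rational hδ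

end HermSpace3

end Summit.HodgeConjecture.CorCM

end
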